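import Mathlib.Analysis.SpecialFunctions.Log.Basic
import Literature.Analysis.FunctionSpaces.HolderInterpolationTorus
import HarnessLib

/-!
# Log-convexity of the `C^{k,α}` norms on the torus: the geometric (Λ-scale) form

Analysis/FunctionSpaces support file (everything proved). From the three-orders interpolation
inequality `‖f‖_{k+1,r}² ≤ 8(k+3)² ‖f‖_{k,r} ‖f‖_{k+2,r}` (`HolderInterpolationTorus.lean`) we
derive the classical log-convexity of `k ↦ ‖f‖_{k,r}` between two orders
(Buckmaster–De Lellis–Székelyhidi–Vicol 2019, App. A (A.4): "the standard interpolation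
inequalities `[f]_s ≤ C ‖f‖₀^{1-s/r} [f]_r^{s/r}`"; Gilbarg–Trudinger 2001, Lemma 6.35), in the
**geometric form** consumed by a priori estimates stated at dyadic-type scales
(`BDSV.holderCZBound.eulerApriori`: data `‖v(t₀)‖_{N,α} ≤ U Λ^{N-1}`):

* `discreteConvex_le` — an elementary lemma on real sequences: if
  `2 b_{i+1} ≤ b_i + b_{i+2} + γ` along `k, …, k+n`, then
  `n b_{k+n₁} ≤ n₂ b_k + n₁ b_{k+n} + 2γn³` for `n₁ + n₂ = n` (convexity up to an error);
* `Torus.eContDiffHolderNorm_le_geometric` — for smooth `f` on `T^d`, `r ≤ 1`, `N ≥ 2`: if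
  `‖f‖_{1,r} ≤ A₁` (`A₁ > 0`), `‖f‖_{N,r} ≤ A_N` and `A_N ≤ A₁ Λ^{N-1}` (`Λ ≥ 0`), then
  `‖f‖_{j,r} ≤ G(N) A₁ Λ^{j-1}` for all `1 ≤ j ≤ N`, with the explicit
  `G(N) = (8(N+3)²)^{2(N-1)²}` (apply `discreteConvex_le` to `b_j = log ‖f‖_{j,r}` and take
  `(N-1)`-st roots).

## References

* T. Buckmaster, C. De Lellis, L. Székelyhidi Jr., V. Vicol, *Onsager's conjecture for admissible
  weak solutions*, Comm. Pure Appl. Math. 72 (2019) 229–274 = arXiv:1701.08678, App. A (A.4).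
  [`BuckmasterEtAl2018`]
* D. Gilbarg, N. S. Trudinger, *Elliptic Partial Differential Equations of Second Order* (2001),
  Lemma 6.35. [`GilbargTrudinger2001`]
-/

noncomputable section

open Set Function
open scoped NNReal ENNReal

namespace Literature.Analysis.FunctionSpaces

universe u

/-! ## Discrete convexity up to an error -/

section Discrete

variable {b : ℕ → ℝ} {γ : ℝ} {k n : ℕ}

/-- Slopes of an almost-convex sequence almost increase: with `d i = b_{k+i+1} - b_{k+i}`,
`d i ≤ d i' + γ (i' - i)` for `i ≤ i'`, `i' + 1 ≤ n`. [folklore] -/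
theorem slope_le_slope_add
    (h : ∀ i, i + 2 ≤ n → 2 * b (k + i + 1) ≤ b (k + i) + b (k + i + 2) + γ) :
    ∀ q i, i + q + 1 ≤ n →
      b (k + i + 1) - b (k + i) ≤ b (k + (i + q) + 1) - b (k + (i + q)) + γ * q := by
  intro q
  induction q with
  | zero => intro i _; simp
  | succ q IH =>
    intro i hi
    have h1 := IH i (by omega)
    have h2 := h (i + q) (by omega)
    rw [show k + (i + (q + 1)) = k + (i + q) + 1 by ring]
    rw [show k + (i + q) + 1 + 1 = k + (i + q) + 2 by ring]
    push_cast
    linarith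

/-- **Discrete convexity up to an error.** If `2 b_{k+i+1} ≤ b_{k+i} + b_{k+i+2} + γ` for
`i + 2 ≤ n` (`γ ≥ 0`), then for `n₁ + n₂ = n`:
`n b_{k+n₁} ≤ n₂ b_k + n₁ b_{k+n} + 2 γ n³` (compare every early increment with every late one
through the pivot increment `b_{k+n₁} - b_{k+n₁-1}`). [folklore] -/
theorem discreteConvex_le (hγ : 0 ≤ γ)
    (h : ∀ i, i + 2 ≤ n → 2 * b (k + i + 1) ≤ b (k + i) + b (k + i + 2) + γ)
    {n₁ n₂ : ℕ} (hn : n₁ + n₂ = n) :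
    (n : ℝ) * b (k + n₁) ≤ n₂ * b k + n₁ * b (k + n) + 2 * γ * (n : ℝ) ^ 3 := by
  rcases Nat.eq_zero_or_pos n₁ with rfl | hn₁
  · subst hn
    simp only [zero_add, Nat.cast_zero, zero_mul, add_zero]
    have : 0 ≤ 2 * γ * (n₂ : ℝ) ^ 3 := by positivity
    linarith
  -- the pivot increment
  obtain ⟨p, rfl⟩ : ∃ p, n₁ = p + 1 := ⟨n₁ - 1, by omega⟩
  set P : ℝ := b (k + p + 1) - b (k + p) with hP
  have hslope := slope_le_slope_add h
  -- early increments: `b_{k+p+1} - b_{k+i} ≤ (p + 1 - i)(P + γ n)`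
  have hearly : ∀ q i, i + q = p + 1 → b (k + p + 1) - b (k + i) ≤ q * (P + γ * n) := by
    intro q
    induction q with
    | zero =>
      intro i hi
      have : k + i = k + p + 1 := by omega
      simp [this]
    | succ q IH =>
      intro i hi
      have h1 := IH (i + 1) (by omega)
      have h2 := hslope q i (by omega)
      have e : k + (i + q) = k + p := by omega
      rw [e] at h2
      have hq : γ * q ≤ γ * n := mul_le_mul_of_nonneg_left (by exact_mod_cast (by omega : q ≤ n)) hγ
      have e2 : k + (i + 1) = k + i + 1 := by ring
      rw [e2] at h1
      push_cast
      nlinarith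
  -- late increments: `b_{k+p+1+q} - b_{k+p+1} ≥ q (P - γ n)`
  have hlate : ∀ q, q ≤ n₂ → q * (P - γ * n) ≤ b (k + p + 1 + q) - b (k + p + 1) := by
    intro q
    induction q with
    | zero => intro _; simp
    | succ q IH =>
      intro hq
      have h1 := IH (by omega)
      have h2 := hslope (q + 1) p (by omega)
      have e1 : k + (p + (q + 1)) + 1 = k + p + 1 + (q + 1) := by ring
      have e2 : k + (p + (q + 1)) = k + p + 1 + q := by ring
      rw [e1, e2] at h2
      have hq' : γ * ((q + 1 : ℕ) : ℝ) ≤ γ * n :=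
        mul_le_mul_of_nonneg_left (by exact_mod_cast (by omega : q + 1 ≤ n)) hγ
      push_cast at h2 hq' ⊢
      nlinarith
  have hE := hearly (p + 1) 0 (by omega)
  have hL := hlate n₂ le_rfl
  rw [add_zero] at hE
  have ekn : k + p + 1 + n₂ = k + n := by omega
  rw [ekn] at hL
  have ej : k + (p + 1) = k + p + 1 := by ring
  rw [ej]
  -- combine
  have hn₂0 : (0 : ℝ) ≤ n₂ := Nat.cast_nonneg n₂
  have hp0 : (0 : ℝ) ≤ p + 1 := by positivity
  have h1 : (n₂ : ℝ) * (b (k + p + 1) - b k) ≤ n₂ * ((p + 1 : ℕ) * (P + γ * n)) :=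
    mul_le_mul_of_nonneg_left hE hn₂0
  have h2 : ((p + 1 : ℕ) : ℝ) * (n₂ * (P - γ * n)) ≤ (p + 1 : ℕ) * (b (k + n) - b (k + p + 1)) :=
    mul_le_mul_of_nonneg_left hL (by exact_mod_cast hp0)
  have hprod : ((p + 1 : ℕ) : ℝ) * n₂ ≤ (n : ℝ) ^ 2 := by
    have : ((p + 1 : ℕ) : ℝ) ≤ n := by exact_mod_cast (by omega : p + 1 ≤ n)
    have : (n₂ : ℝ) ≤ n := by exact_mod_cast (by omega : n₂ ≤ n)
    nlinarith
  have hnR : (n : ℝ) = (p + 1 : ℕ) + n₂ := by rw [← hn]; push_cast; ring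
  have hγn : 0 ≤ γ * n := mul_nonneg hγ (Nat.cast_nonneg n)
  push_cast at h1 h2 hprod hnR ⊢
  have e3 : (n : ℝ) * b (k + p + 1) = ((p : ℝ) + 1) * b (k + p + 1) + n₂ * b (k + p + 1) := by
    rw [hnR]; ring
  have hcube : ((p : ℝ) + 1) * n₂ * (γ * n) ≤ (n : ℝ) ^ 2 * (γ * n) :=
    mul_le_mul_of_nonneg_right hprod hγn
  nlinarith [h1, h2, hcube, e3, hγn]

end Discrete

/-! ## The geometric form on the torus -/

namespace Torus

variable {d : Type u} [Fintype d] {Y : Type u} [NormedAddCommGroup Y] [NormedSpace ℝ Y]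

/-- For a smooth function on the torus either all `C^{k,r}` norms vanish or all are positive
(and finite, `r ≤ 1`): if `‖f‖_∞ = 0` then `f = 0`. [folklore] -/
theorem eContDiffHolderNorm_toReal_pos_or_eq_zero {f : UnitAddTorus d → Y} (hf : IsSmooth f)
    {r : ℝ≥0} (hr : r ≤ 1) :
    (∀ k, 0 < (Torus.eContDiffHolderNorm k r f).toReal) ∨
      ∀ k, Torus.eContDiffHolderNorm k r f = 0 := by
  by_cases h0 : eSupNorm f = 0
  · right
    have hf0 : f = 0 := by
      funext x
      have hx : ‖f x‖ₑ ≤ 0 := h0 ▸ enorm_le_eSupNorm f x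
      simpa using hx
    intro k
    rw [hf0]
    exact Torus.eContDiffHolderNorm_zero_fun k r
  · left
    intro k
    refine ENNReal.toReal_pos (fun h => h0 ?_) (hf.eContDiffHolderNorm_lt_top k hr).ne
    exact le_antisymm (h ▸ Torus.eSupNorm_le_eContDiffHolderNorm k r f) bot_le

/-- The three-orders inequality in real form for smooth `f`, `r ≤ 1`:
`a_{k+1}² ≤ 8 (k+3)² a_k a_{k+2}` with `a_k = (‖f‖_{k,r}).toReal`. [folklore] -/
theorem sq_toReal_eContDiffHolderNorm_succ_le {f : UnitAddTorus d → Y} (hf : IsSmooth f)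
    {r : ℝ≥0} (hr : r ≤ 1) (k : ℕ) :
    (Torus.eContDiffHolderNorm (k + 1) r f).toReal ^ 2 ≤
      8 * ((k : ℝ) + 3) ^ 2 * (Torus.eContDiffHolderNorm k r f).toReal *
        (Torus.eContDiffHolderNorm (k + 2) r f).toReal := by
  have h := Torus.sq_eContDiffHolderNorm_succ_le hf hr k
  have hfin : ∀ j, Torus.eContDiffHolderNorm j r f ≠ ⊤ := fun j =>
    (hf.eContDiffHolderNorm_lt_top j hr).ne
  have hk3 : ((k : ℝ≥0∞) + 3) = ((k + 3 : ℕ) : ℝ≥0∞) := by push_cast; rfl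
  have hR : (8 * ((k + 3 : ℝ≥0∞) * Torus.eContDiffHolderNorm k r f) *
      ((k + 3 : ℝ≥0∞) * Torus.eContDiffHolderNorm (k + 2) r f)) ≠ ⊤ := by
    rw [hk3]
    exact ENNReal.mul_ne_top (ENNReal.mul_ne_top (by norm_num)
      (ENNReal.mul_ne_top (ENNReal.natCast_ne_top _) (hfin k)))
      (ENNReal.mul_ne_top (ENNReal.natCast_ne_top _) (hfin (k + 2)))
  have h' := ENNReal.toReal_mono hR h
  rw [ENNReal.toReal_pow] at h'
  refine h'.trans (le_of_eq ?_)
  rw [hk3]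
  simp only [ENNReal.toReal_mul, ENNReal.toReal_natCast, ENNReal.toReal_ofNat]
  push_cast
  ring

/-- **Log-convexity of the Hölder norms, geometric form** (BDSV App. A (A.4); Gilbarg–Trudinger
Lemma 6.35): for smooth `f` on `T^d`, `r ≤ 1`, `N ≥ 2`, if `‖f‖_{1,r} ≤ A₁` with `A₁ > 0`,
`‖f‖_{N,r} ≤ A_N` and `A_N ≤ A₁ Λ^{N-1}` for some `Λ ≥ 0`, then all intermediate norms lie below
the geometric interpolant: `‖f‖_{j,r} ≤ G A₁ Λ^{j-1}` for `1 ≤ j ≤ N`, with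
`G = (8(N+3)²)^{2(N-1)²}`. [cite: BuckmasterEtAl2018, App. A (A.4)] -/
theorem eContDiffHolderNorm_le_geometric {N : ℕ} (hN : 2 ≤ N) {f : UnitAddTorus d → Y}
    (hf : IsSmooth f) {r : ℝ≥0} (hr : r ≤ 1) {A₁ AN Λ : ℝ} (hA₁ : 0 < A₁) (hΛ : 0 ≤ Λ)
    (h1 : Torus.eContDiffHolderNorm 1 r f ≤ ENNReal.ofReal A₁)
    (hNle : Torus.eContDiffHolderNorm N r f ≤ ENNReal.ofReal AN) (hAN : AN ≤ A₁ * Λ ^ (N - 1))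
    {j : ℕ} (hj1 : 1 ≤ j) (hjN : j ≤ N) :
    Torus.eContDiffHolderNorm j r f ≤
      ENNReal.ofReal ((8 * ((N : ℝ) + 3) ^ 2) ^ (2 * (N - 1) ^ 2) * A₁ * Λ ^ (j - 1)) := by
  set Λ₀ : ℝ := 8 * ((N : ℝ) + 3) ^ 2 with hΛ₀
  have hΛ₀1 : 1 ≤ Λ₀ := by
    have : (3 : ℝ) ≤ (N : ℝ) + 3 := by linarith [Nat.cast_nonneg (α := ℝ) N]
    rw [hΛ₀]; nlinarith
  set G : ℝ := Λ₀ ^ (2 * (N - 1) ^ 2) with hG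
  have hG1 : 1 ≤ G := one_le_pow₀ hΛ₀1
  have hfin : ∀ i, Torus.eContDiffHolderNorm i r f ≠ ⊤ := fun i =>
    (hf.eContDiffHolderNorm_lt_top i hr).ne
  have hRHS0 : 0 ≤ G * A₁ * Λ ^ (j - 1) := by positivity
  rcases eContDiffHolderNorm_toReal_pos_or_eq_zero hf hr with hpos | hzero
  swap
  · rw [hzero j]; exact bot_le
  -- all norms positive reals `a i`
  set a : ℕ → ℝ := fun i => (Torus.eContDiffHolderNorm i r f).toReal with ha
  have ha_eq : ∀ i, Torus.eContDiffHolderNorm i r f = ENNReal.ofReal (a i) := fun i =>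
    (ENNReal.ofReal_toReal (hfin i)).symm
  have hA1 : a 1 ≤ A₁ := (ENNReal.ofReal_le_ofReal_iff hA₁.le).1 (by rw [← ha_eq]; exact h1)
  have hANpos : 0 < AN := by
    have h0 : ENNReal.ofReal (a N) ≤ ENNReal.ofReal AN := by rw [← ha_eq]; exact hNle
    by_contra hneg
    rw [not_lt] at hneg
    have : ENNReal.ofReal (a N) ≤ 0 := h0.trans (by rw [ENNReal.ofReal_of_nonpos hneg])
    have : a N ≤ 0 := by
      have h' := (ENNReal.ofReal_eq_zero.1 (le_antisymm this bot_le))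
      exact h'
    linarith [hpos N]
  have hANle : a N ≤ AN := (ENNReal.ofReal_le_ofReal_iff hANpos.le).1 (by rw [← ha_eq]; exact hNle)
  -- logarithms
  set c : ℕ → ℝ := fun i => Real.log (a (1 + i)) with hc
  set γ : ℝ := Real.log Λ₀ with hγ
  have hγ0 : 0 ≤ γ := Real.log_nonneg hΛ₀1
  have hconv : ∀ i, i + 2 ≤ N - 1 → 2 * c (0 + i + 1) ≤ c (0 + i) + c (0 + i + 2) + γ := by
    intro i hi
    simp only [hc, zero_add]
    have h3 := sq_toReal_eContDiffHolderNorm_succ_le hf hr (1 + i)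
    have hi3 : 8 * (((1 + i : ℕ) : ℝ) + 3) ^ 2 ≤ Λ₀ := by
      rw [hΛ₀]
      have : (((1 + i : ℕ) : ℝ) + 3) ≤ (N : ℝ) + 3 := by
        have : ((1 + i : ℕ) : ℝ) ≤ N := by exact_mod_cast (by omega : 1 + i ≤ N)
        linarith
      have h0 : (0 : ℝ) ≤ ((1 + i : ℕ) : ℝ) + 3 := by positivity
      nlinarith
    have h4 : a (1 + i + 1) ^ 2 ≤ Λ₀ * a (1 + i) * a (1 + i + 2) := by
      refine h3.trans ?_
      have := mul_le_mul_of_nonneg_right hi3 (mul_nonneg (hpos (1 + i)).le (hpos (1 + i + 2)).le)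
      nlinarith [this]
    have e1 : 1 + (i + 1) = 1 + i + 1 := by ring
    have e2 : 1 + (i + 2) = 1 + i + 2 := by ring
    rw [e1, e2]
    have hlog := Real.log_le_log (pow_pos (hpos _) 2) h4
    rw [Real.log_pow, Real.log_mul (mul_pos (by linarith) (hpos _)).ne' (hpos _).ne',
      Real.log_mul (by linarith) (hpos _).ne'] at hlog
    push_cast at hlog
    linarith
  -- discrete convexity between the orders `1` and `N`
  obtain ⟨n₁, hn₁⟩ : ∃ n₁, j = 1 + n₁ := ⟨j - 1, by omega⟩
  have hdc := discreteConvex_le (k := 0) (n := N - 1) hγ0 hconv (n₁ := n₁) (n₂ := N - j) (by omega)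
  simp only [hc, zero_add] at hdc
  have eN : 1 + (N - 1) = N := by omega
  rw [eN, ← hn₁] at hdc
  -- exponentiate: `a_j^{N-1} ≤ Λ₀^{2(N-1)^3} a_1^{N-j} a_N^{j-1}`
  have hexp : a j ^ (N - 1) ≤ Λ₀ ^ (2 * (N - 1) ^ 3) * (a 1 ^ (N - j) * a N ^ (j - 1)) := by
    have hn₁' : n₁ = j - 1 := by omega
    rw [hn₁'] at hdc
    have hlhs : ((N - 1 : ℕ) : ℝ) * Real.log (a j) = Real.log (a j ^ (N - 1)) := by
      rw [Real.log_pow]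
    have p1 : 0 < a 1 ^ (N - j) := pow_pos (hpos 1) _
    have p2 : 0 < a N ^ (j - 1) := pow_pos (hpos N) _
    have p3 : 0 < Λ₀ ^ (2 * (N - 1) ^ 3) := pow_pos (by linarith) _
    have hrhs : ((N - j : ℕ) : ℝ) * Real.log (a 1) + ((j - 1 : ℕ) : ℝ) * Real.log (a N) +
        2 * γ * ((N - 1 : ℕ) : ℝ) ^ 3 =
        Real.log (Λ₀ ^ (2 * (N - 1) ^ 3) * (a 1 ^ (N - j) * a N ^ (j - 1))) := by
      rw [Real.log_mul p3.ne' (mul_pos p1 p2).ne', Real.log_mul p1.ne' p2.ne', Real.log_pow,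
        Real.log_pow, Real.log_pow, hγ]
      push_cast
      ring
    rw [hlhs, hrhs] at hdc
    exact (Real.log_le_log_iff (pow_pos (hpos j) _) (mul_pos p3 (mul_pos p1 p2))).1 hdc
  -- compare with `(G A₁ Λ^{j-1})^{N-1}`
  have hkey : a j ^ (N - 1) ≤ (G * A₁ * Λ ^ (j - 1)) ^ (N - 1) := by
    refine hexp.trans ?_
    have h1' : a 1 ^ (N - j) ≤ A₁ ^ (N - j) := pow_le_pow_left₀ (hpos 1).le hA1 _
    have h2' : a N ^ (j - 1) ≤ (A₁ * Λ ^ (N - 1)) ^ (j - 1) :=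
      pow_le_pow_left₀ (hpos N).le (hANle.trans hAN) _
    have hGpow : Λ₀ ^ (2 * (N - 1) ^ 3) = G ^ (N - 1) := by
      rw [hG, ← pow_mul]
      congr 1
      ring
    calc Λ₀ ^ (2 * (N - 1) ^ 3) * (a 1 ^ (N - j) * a N ^ (j - 1))
        ≤ G ^ (N - 1) * (A₁ ^ (N - j) * (A₁ * Λ ^ (N - 1)) ^ (j - 1)) := by
          rw [hGpow]
          exact mul_le_mul_of_nonneg_left (mul_le_mul h1' h2' (by positivity) (by positivity))
            (by positivity)
      _ = (G * A₁ * Λ ^ (j - 1)) ^ (N - 1) := by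
          have eN : N - 1 = (N - j) + (j - 1) := by omega
          rw [eN]
          ring
  have hroot : a j ≤ G * A₁ * Λ ^ (j - 1) :=
    (pow_le_pow_iff_left₀ (hpos j).le hRHS0 (by omega : N - 1 ≠ 0)).1 hkey
  rw [ha_eq j]
  exact ENNReal.ofReal_le_ofReal hroot

end Torus

end Literature.Analysis.FunctionSpaces
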